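import Summits.QuantumFields.YangMills.Theorems.ParabolicTrajectoryContinuumLimitOnTrajectoryStubOSLegsA_Lattice

/-!
# Crux `ContinuumLimitOnTrajectory` (stmt-QuantumFields-10522), line `two-orbit-synchronisation` (seat c2):
# lattice observables of multi-point test functions

Helper file (`--supports stmt-QuantumFields-10522`) for the registered stub `stub_uclOfGap : UCLOfGap` (skeleton v3.1).
The canonical curvature distribution `curvDistribution r sch k p F` is the torus Wilson expectation of a COMPLEX LATTICE OBSERVABLE
`obsOf r sch k p F : U ↦ ∑_{x ∈ (box 4 L_k)^p} F(a_k x⃗) ∏ᵢ cw(xᵢ)(U)` (`cw` = centred unit-weight corner density at `xᵢ`, OSLegsA). This file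
records the elementary algebra and analysis of these observables that the clustering leg consumes:

* `obsOf`, `curvDistribution_eq_integral_obsOf` (by `rfl`), measurability, the sup bound
  `‖obsOf F U‖ ≤ (∑ₓ ‖F(a_k x⃗)‖) · C^p` and integrability;
* `obsOf_appendTensor` — on an appended tensor `F ⊗ G'` the observable is the PRODUCT `obsOf F · obsOf G'`, whence
  `curvDistribution_appendTensor : curvDistribution (n+m) (F ⊗ G') = ∫ obsOf F · obsOf G' dμ_k` and the covariance form of the truncated function
  `truncated_eq_covariance`;
* `norm_integral_mul_sub_le` — the crude clustering bound by sup norms, `‖∫AB − ∫A ∫B‖ ≤ 2 ‖A‖_∞ ‖B‖_∞` (tails).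

Vocabulary: OSLegsA (`cw`, `μW`); nothing about Wilson's theory is asserted. Refs: Glimm–Jaffe 1987 §6.1; Osterwalder–Seiler 1978 §2.
-/

set_option autoImplicit false

open scoped SchwartzMap ComplexConjugate
open MeasureTheory Filter Topology
open Literature.MathematicalPhysics.QuantumFieldTheory Literature.MathematicalPhysics.QuantumLattice
open Literature.MathematicalPhysics.AQFT Literature.Probability.LatticeModels

noncomputable section

namespace Summit.QuantumFields.YangMills.Cruxes.ContinuumLimitOnTrajectory.TwoOrbitSynchronisation

local notation "𝔼" => EuclideanSpace ℝ (Fin 4)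

variable {G : Type} [Group G] [TopologicalSpace G] [IsTopologicalGroup G] [CompactSpace G]
  [MeasurableSpace G] [BorelSpace G]

/-! ## The lattice observable of a `p`-point test function -/

/-- **The complex lattice observable of a `p`-point test function** at step `k`:
`U ↦ ∑_{x ∈ (box 4 L_k)^p} F(a_k x⃗) ∏ᵢ cw(xᵢ)(U)` — the integrand of `curvDistribution r sch k p F`. -/
def obsOf (r : LatticeRep G) (sch : SpeciesScheme (YMSpecies G)) (k p : ℕ) (F : 𝓢((Fin p → 𝔼), ℂ))
    (U : GaugeConfig 4 (sch.side k) G) : ℂ :=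
  ∑ x : Fin p → ↥(box 4 (sch.L k)), F (fun i => sch.a k • siteToE (↑(x i) : Site 4)) *
    ∏ i, ((cw r sch k (↑(x i)) U : ℝ) : ℂ)

/-- `curvDistribution` is the expectation of `obsOf` (definitional). -/
theorem curvDistribution_eq_integral_obsOf (r : LatticeRep G) (sch : SpeciesScheme (YMSpecies G)) (k p : ℕ)
    (F : 𝓢((Fin p → 𝔼), ℂ)) : curvDistribution r sch k p F = ∫ U, obsOf r sch k p F U ∂(μW r sch k) := rfl

/-- The observable is measurable. -/
theorem measurable_obsOf (r : LatticeRep G) (sch : SpeciesScheme (YMSpecies G)) (k p : ℕ) (F : 𝓢((Fin p → 𝔼), ℂ)) :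
    Measurable (obsOf r sch k p F) := by
  refine Finset.measurable_sum _ fun x _ => measurable_const.mul ?_
  exact Finset.measurable_prod _ fun i _ => Complex.measurable_ofReal.comp (measurable_cw r sch k (x i))

/-- **Sup bound**: `‖obsOf F U‖ ≤ (∑ₓ ‖F(a_k x⃗)‖) · |C|^p` with `C` a bound on the curvature weights. -/
theorem norm_obsOf_le (r : LatticeRep G) (sch : SpeciesScheme (YMSpecies G)) (k p : ℕ) {C : ℝ}
    (hC : ∀ x U, |cw r sch k x U| ≤ C) (F : 𝓢((Fin p → 𝔼), ℂ)) (U : GaugeConfig 4 (sch.side k) G) :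
    ‖obsOf r sch k p F U‖ ≤
      (∑ x : Fin p → ↥(box 4 (sch.L k)), ‖F (fun i => sch.a k • siteToE (↑(x i) : Site 4))‖) * |C| ^ p := by
  unfold obsOf
  rw [Finset.sum_mul]
  refine (norm_sum_le _ _).trans (Finset.sum_le_sum fun x _ => ?_)
  rw [norm_mul, norm_prod]
  refine mul_le_mul_of_nonneg_left ?_ (norm_nonneg _)
  calc ∏ i, ‖((cw r sch k (↑(x i)) U : ℝ) : ℂ)‖ ≤ ∏ _i : Fin p, |C| :=
        Finset.prod_le_prod (fun i _ => norm_nonneg _) fun i _ => by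
          rw [Complex.norm_real, Real.norm_eq_abs]; exact (hC _ _).trans (le_abs_self C)
    _ = |C| ^ p := by simp

/-- The observable is bounded. -/
theorem exists_bound_obsOf (r : LatticeRep G) (sch : SpeciesScheme (YMSpecies G)) (k p : ℕ) (F : 𝓢((Fin p → 𝔼), ℂ)) :
    ∃ B : ℝ, ∀ U, ‖obsOf r sch k p F U‖ ≤ B := by
  obtain ⟨C, hC⟩ := exists_bound_cw r sch k
  exact ⟨_, fun U => norm_obsOf_le r sch k p hC F U⟩

/-- The observable is integrable (bounded measurable, probability measure). -/
theorem integrable_obsOf (r : LatticeRep G) (sch : SpeciesScheme (YMSpecies G)) (k p : ℕ) (F : 𝓢((Fin p → 𝔼), ℂ)) :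
    Integrable (obsOf r sch k p F) (μW r sch k) := by
  obtain ⟨B, hB⟩ := exists_bound_obsOf r sch k p F
  exact Integrable.of_bound (measurable_obsOf r sch k p F).aestronglyMeasurable B (Eventually.of_forall hB)

/-! ## Products: appended tensors -/

/-- **Product formula**: the observable of an appended tensor is the product of the observables. -/
theorem obsOf_appendTensor (r : LatticeRep G) (sch : SpeciesScheme (YMSpecies G)) (k n m : ℕ)
    (F : 𝓢((Fin n → 𝔼), ℂ)) (G' : 𝓢((Fin m → 𝔼), ℂ)) (U : GaugeConfig 4 (sch.side k) G) :
    obsOf r sch k (n + m) (F.appendTensor G') U = obsOf r sch k n F U * obsOf r sch k m G' U := by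
  unfold obsOf
  rw [Finset.sum_mul_sum, ← (Fin.appendEquiv n m).sum_comp, Fintype.sum_prod_type]
  refine Finset.sum_congr rfl fun y _ => Finset.sum_congr rfl fun z _ => ?_
  simp only [Fin.appendEquiv_apply, SchwartzMap.appendTensor_apply, Fin.prod_univ_add, Function.comp_def,
    Fin.append_left, Fin.append_right]
  ring

/-- **The truncated function is a covariance**: `curvDistribution (n+m) (F ⊗ G') = ∫ obsOf F · obsOf G' dμ_k`. -/
theorem curvDistribution_appendTensor :
    ∀ {G : Type} [Group G] [TopologicalSpace G] [IsTopologicalGroup G] [CompactSpace G] [MeasurableSpace G] [BorelSpace G]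
      (r : LatticeRep G) (sch : SpeciesScheme (YMSpecies G)) (k n m : ℕ)
      (F : 𝓢((Fin n → EuclideanSpace ℝ (Fin 4)), ℂ)) (G' : 𝓢((Fin m → EuclideanSpace ℝ (Fin 4)), ℂ)),
      curvDistribution r sch k (n + m) (F.appendTensor G') =
        ∫ U, obsOf r sch k n F U * obsOf r sch k m G' U ∂(μW r sch k) := by
  intro G _ _ _ _ _ _ r sch k n m F G'
  rw [curvDistribution_eq_integral_obsOf]
  exact integral_congr_ae (Eventually.of_forall fun U => obsOf_appendTensor r sch k n m F G' U)

/-- The witness form: for any `H` with `IsAppendTensorOf H F G'`, `curvDistribution (n+m) H = ∫ obsOf F · obsOf G'`. -/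
theorem curvDistribution_of_isAppendTensorOf (r : LatticeRep G) (sch : SpeciesScheme (YMSpecies G)) (k n m : ℕ)
    {H : 𝓢((Fin (n + m) → 𝔼), ℂ)} {F : 𝓢((Fin n → 𝔼), ℂ)} {G' : 𝓢((Fin m → 𝔼), ℂ)} (hH : IsAppendTensorOf H F G') :
    curvDistribution r sch k (n + m) H = ∫ U, obsOf r sch k n F U * obsOf r sch k m G' U ∂(μW r sch k) := by
  have hH' : H = F.appendTensor G' := by
    ext x; rw [hH x, SchwartzMap.appendTensor_apply]
  rw [hH', curvDistribution_appendTensor]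

/-- **Truncated function = covariance of the two observables.** -/
theorem truncated_eq_covariance (r : LatticeRep G) (sch : SpeciesScheme (YMSpecies G)) (k n m : ℕ)
    {H : 𝓢((Fin (n + m) → 𝔼), ℂ)} {F : 𝓢((Fin n → 𝔼), ℂ)} {G' : 𝓢((Fin m → 𝔼), ℂ)} (hH : IsAppendTensorOf H F G') :
    curvDistribution r sch k (n + m) H - curvDistribution r sch k n F * curvDistribution r sch k m G' =
      (∫ U, obsOf r sch k n F U * obsOf r sch k m G' U ∂(μW r sch k)) -
        (∫ U, obsOf r sch k n F U ∂(μW r sch k)) * ∫ U, obsOf r sch k m G' U ∂(μW r sch k) := by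
  rw [curvDistribution_of_isAppendTensorOf r sch k n m hH, curvDistribution_eq_integral_obsOf,
    curvDistribution_eq_integral_obsOf]

/-! ## The crude clustering bound by sup norms -/

/-- **Covariances are bounded by sup norms**: on a probability space, `‖∫AB − ∫A ∫B‖ ≤ 2 ‖A‖_∞ ‖B‖_∞` for measurable `A, B`
bounded by `a, b ≥ 0`. -/
theorem norm_integral_mul_sub_le {Ω : Type*} [MeasurableSpace Ω] (μ : Measure Ω) [IsProbabilityMeasure μ]
    {A B : Ω → ℂ} {a b : ℝ} (ha0 : 0 ≤ a) (ha : ∀ ω, ‖A ω‖ ≤ a) (hb : ∀ ω, ‖B ω‖ ≤ b) :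
    ‖(∫ ω, A ω * B ω ∂μ) - (∫ ω, A ω ∂μ) * ∫ ω, B ω ∂μ‖ ≤ 2 * a * b := by
  have h1 : ‖∫ ω, A ω * B ω ∂μ‖ ≤ a * b := by
    have h := norm_integral_le_of_norm_le_const (μ := μ) (f := fun ω => A ω * B ω) (C := a * b)
      (Eventually.of_forall fun ω => ?_)
    · rwa [probReal_univ, mul_one] at h
    · rw [norm_mul]; exact mul_le_mul (ha ω) (hb ω) (norm_nonneg _) ha0
  have h2 : ‖∫ ω, A ω ∂μ‖ ≤ a := by
    have h := norm_integral_le_of_norm_le_const (μ := μ) (f := A) (C := a) (Eventually.of_forall ha)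
    rwa [probReal_univ, mul_one] at h
  have h3 : ‖∫ ω, B ω ∂μ‖ ≤ b := by
    have h := norm_integral_le_of_norm_le_const (μ := μ) (f := B) (C := b) (Eventually.of_forall hb)
    rwa [probReal_univ, mul_one] at h
  calc ‖(∫ ω, A ω * B ω ∂μ) - (∫ ω, A ω ∂μ) * ∫ ω, B ω ∂μ‖
      ≤ ‖∫ ω, A ω * B ω ∂μ‖ + ‖(∫ ω, A ω ∂μ) * ∫ ω, B ω ∂μ‖ := norm_sub_le _ _
    _ ≤ a * b + a * b := by
        rw [norm_mul]; exact add_le_add h1 (mul_le_mul h2 h3 (norm_nonneg _) ha0)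
    _ = 2 * a * b := by ring

end Summit.QuantumFields.YangMills.Cruxes.ContinuumLimitOnTrajectory.TwoOrbitSynchronisation

end
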